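import Literature.Analysis.FluidPDE.ParabolicSobolevHolderEmbeddingHolds
import Literature.Analysis.FluidPDE.HeatPotentialTestRepresentation
import Literature.Analysis.FluidPDE.DistributionalPressurePoisson
import Literature.Analysis.FluidPDE.SteadyLiouvilleTsaiVorticity
import HarnessLib

/-!
# Interior parabolic Hölder bound for smooth fields through the heat operator

Analysis/FluidPDE support file (everything proved, no definitions, no named facts) on the
discharge path of the named fact `Literature.Analysis.FluidPDE.StokesLocalHolderBound`
(`FluidPDE/SereginLocalStokesRegularity`; G. Seregin, *Lecture notes on regularity theory for
the Navier–Stokes equations* (2014), §4.6, Prop. 6.7 & 6.8: distributional solutions of the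
Stokes system with `u, ∇u, p, f ∈ L_{s,n}(Q)` are parabolic-Hölder of exponent
`μ = 2 - 2/n - 3/s` on `Q(1/2)`). The discharge mollifies the solution and needs, for the
**smooth** regularised velocity `v`, the following a priori interior estimate, in which only
`v`, `D_x v` and the heat operator `(∂ₜ - Δ)v` enter (no second derivatives, no time derivative
alone — this is what allows one to bypass the `W^{2,1}_{s,n}` estimate of Prop. 6.7 and to use
only its pressure-gradient part, `∂ₜv - Δv = f - ∇p`):

* `exists_holder_bound_smooth_heat` — for `1 < s`, `1 < n` with `0 < μ = 2 - 2/n - 3/s < 1`,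
  radii `0 < r₁ < r₂` and a spatial centre `x₀` there is `C` such that for every time `t₁` and
  every jointly smooth `v : ℝ × ℝ³ → ℝ³`, writing `Q = Q((t₁,x₀), r₂)` and
  `S = ‖v‖_{s,n,Q} + ‖D_xv‖_{s,n,Q} + ‖∂ₜv - Δv‖_{s,n,Q}` (assumed finite),
  `‖v(z_a) - v(z_b)‖ ≤ C S (|x_a - x_b| + |t_a - t_b|^{1/2})^μ` for all
  `z_a, z_b ∈ Q((t₁,x₀), r₁)` (written with `edist` in `ℝ≥0∞`, the format of the named fact).

Proof (Seregin 2014, Prop. 6.8 via heat potentials, for smooth functions): with a product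
cut-off `φ = 1` on `Q((t₁,x₀), ρ₁)`, `r₁ < ρ₁ < ρ₂ < r₂`, and — for a given pair of points with
times `≤ T < t₁` — a time cut-off `ζ = 1` on `]-∞, T]`, `ζ = 0` near `t₁`, each coordinate
`Φᵢ = ζ φ vᵢ` is a space–time test field, hence equals the forward heat potential of
`(∂ₜ - Δ)Φᵢ` (`IsSpaceTimeTestOn.heatPotential_heatOperator`, Duhamel); by causality of the
forward heat kernel the potential at times `≤ T` only sees the source below `T`, where `ζ ≡ 1`
and `(∂ₜ - Δ)(φvᵢ) = φ(∂ₜvᵢ - Δvᵢ) + (∂ₜφ - Δφ)vᵢ - 2∇φ·∇vᵢ`, an `L_{s,n}` function of mixed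
norm `≤ 6M S`; the parabolic Hölder continuity of heat potentials of `L_{s,n}` data
(`exists_parabolicHolderOnWith_heatPotential_of_mixedNorm`) concludes, with a constant
independent of `T` and of `t₁` (the cut-offs are translates of fixed profiles).

## References

* G. Seregin, *Lecture notes on regularity theory for the Navier–Stokes equations*, World
  Scientific (2014), §4.6, Prop. 6.7–6.8, pp. 58–60. [`Seregin2014`]
* L. C. Evans, *Partial Differential Equations*, 2nd ed. (2010), §2.3.1 Thm. 2 (Duhamel).
  [`Evans2010`]
* P. G. Lemarié-Rieusset, *The Navier–Stokes Problem in the 21st Century* (2016), Prop. 13.4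
  pp. 464–465 (heat potentials of Morrey data). [`LemarieRieusset2016`]
-/

noncomputable section

open MeasureTheory TopologicalSpace Set Function Metric Filter InnerProductSpace
open scoped InnerProductSpace RealInnerProductSpace ENNReal NNReal Topology Laplacian ContDiff

namespace Literature.Analysis.FluidPDE

open Tsai2021

/-! ### Elementary tools -/

section Tools

/-- **A smooth time cut-off**: for `T < T'` there is `ζ ∈ C^∞(ℝ)` with `ζ = 1` on `]-∞, T]` and
`ζ = 0` on `[T', ∞[` (Mathlib's `Real.smoothTransition`). [folklore] -/
theorem exists_time_cutoff_le_eq_one {T T' : ℝ} (h : T < T') :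
    ∃ ζ : ℝ → ℝ, ContDiff ℝ ∞ ζ ∧ (∀ t, t ≤ T → ζ t = 1) ∧ (∀ t, T' ≤ t → ζ t = 0) := by
  refine ⟨fun t => Real.smoothTransition ((T' - t) / (T' - T)), ?_, ?_, ?_⟩
  · exact (Real.smoothTransition.contDiff (n := ⊤)).comp
      ((contDiff_const.sub contDiff_id).div_const _)
  · intro t ht
    apply Real.smoothTransition.one_of_one_le
    rw [le_div_iff₀ (by linarith)]
    linarith
  · intro t ht
    apply Real.smoothTransition.zero_of_nonpos
    exact div_nonpos_of_nonpos_of_nonneg (by linarith) (by linarith)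

variable {F' : Type*} [NormedAddCommGroup F'] [NormedSpace ℝ F']

/-- The spatial differential of the slices of a jointly `C¹` field, `w ↦ D_x v(w.1, ·)(w.2)`, is
jointly continuous (it is the joint differential composed with the inclusion `x ↦ (0, x)`).
[folklore] -/
theorem continuous_fderiv_slice_of_uncurry {X : Type*} [NormedAddCommGroup X] [NormedSpace ℝ X]
    {v : ℝ → X → F'} (hv : ContDiff ℝ ∞ (uncurry v)) :
    Continuous fun w : ℝ × X => fderiv ℝ (v w.1) w.2 := by
  have h1 : (fun w : ℝ × X => fderiv ℝ (v w.1) w.2) =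
      fun w => (fderiv ℝ (uncurry v) w).comp (ContinuousLinearMap.inr ℝ ℝ X) := by
    funext w
    have hd : DifferentiableAt ℝ (uncurry v) (w.1, w.2) := hv.differentiable (by simp) _
    have := hd.hasFDerivAt.comp w.2 (hasFDerivAt_prodMk_right (𝕜 := ℝ) w.1 w.2)
    exact this.fderiv
  rw [h1]
  exact (hv.continuous_fderiv (by simp)).clm_comp continuous_const

/-- The slice Laplacian `w ↦ Δ(v(w.1, ·))(w.2)` of a jointly smooth field on `ℝ × E` is jointly
continuous (`Δ = Σᵢ ∂ᵢ∂ᵢ` over an orthonormal frame). [folklore] -/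
theorem continuous_laplacian_slice_of_uncurry {E : Type*} [NormedAddCommGroup E]
    [InnerProductSpace ℝ E] [FiniteDimensional ℝ E] {v : ℝ → E → F'}
    (hv : ContDiff ℝ ∞ (uncurry v)) : Continuous fun w : ℝ × E => (Δ (v w.1)) w.2 := by
  set b := stdOrthonormalBasis ℝ E
  have h2 : ∀ t, ContDiff ℝ 2 (v t) := fun t =>
    (hv.comp (contDiff_prodMk_right t)).of_le (by norm_cast)
  have heq : (fun w : ℝ × E => (Δ (v w.1)) w.2) =
      fun w => ∑ i, fderiv ℝ (fun y => fderiv ℝ (v w.1) y (b i)) w.2 (b i) := by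
    funext w
    exact laplacian_eq_sum_fderiv_fderiv_normed b (h2 w.1) w.2
  rw [heq]
  exact continuous_finsetSum _ fun i _ =>
    (contDiff_uncurry_fderiv_apply_of_uncurry
      (contDiff_uncurry_fderiv_apply_of_uncurry hv (b i)) (b i)).continuous

/-- Time derivatives commute with coordinates: `(∂ₜv)ᵢ = ∂ₜ(vᵢ)` for a jointly `C¹` field
`v : ℝ × ℝ³ → ℝ³`. [folklore] -/
theorem timeDeriv_apply_coord {v : ℝ → EuclideanSpace ℝ (Fin 3) → EuclideanSpace ℝ (Fin 3)}
    (hv : ContDiff ℝ ∞ (uncurry v)) (t : ℝ) (x : EuclideanSpace ℝ (Fin 3)) (i : Fin 3) :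
    timeDeriv v t x i = timeDeriv (fun s y => v s y i) t x := by
  simp only [timeDeriv]
  have hd : DifferentiableAt ℝ (fun s => v s x) t :=
    ((hv.differentiable (by simp)).comp (differentiable_id.prodMk (differentiable_const x))) t
  have h := ((EuclideanSpace.proj i : EuclideanSpace ℝ (Fin 3) →L[ℝ] ℝ).hasFDerivAt.comp_hasDerivAt
    t hd.hasDerivAt).deriv
  exact h.symm

end Tools

/-! ### The estimate -/

section Main

set_option maxHeartbeats 800000 in
/-- **Interior parabolic Hölder bound for smooth fields through `v`, `D_xv` and `(∂ₜ - Δ)v`.**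
For `1 < s`, `1 < n` with `0 < μ = 2 - 2/n - 3/s < 1`, radii `0 < r₁ < r₂` and a spatial centre
`x₀` there is `C` such that for every `t₁` and every jointly smooth `v : ℝ × ℝ³ → ℝ³` with
`S = ‖v‖_{s,n,Q} + ‖D_xv‖_{s,n,Q} + ‖∂ₜv - Δv‖_{s,n,Q} < ⊤`, `Q = Q((t₁,x₀), r₂)`, one has
`‖v(z_a) - v(z_b)‖ ≤ C S (|x_a - x_b| + |t_a - t_b|^{1/2})^μ` for all `z_a, z_b ∈ Q((t₁,x₀), r₁)`
(heat-potential representation of the cut-off coordinates `ζφvᵢ` below a time cut-off,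
causality of the forward heat kernel, and the parabolic Hölder continuity of heat potentials of
`L_{s,n}` data; Seregin 2014, Prop. 6.8 for smooth functions, with the heat operator in place
of `∂ₜv`, `∇²v`). [cite: Seregin2014, §4.6 Prop. 6.8 (p. 60), Prop. 6.7 proof pp. 58–60] -/
theorem exists_holder_bound_smooth_heat {s n : ℝ} (hs : 1 < s) (hn : 1 < n)
    (hμ : 0 < 2 - 2 / n - 3 / s) (hμ1 : 2 - 2 / n - 3 / s < 1) {r₁ r₂ : ℝ} (hr₁ : 0 < r₁)
    (hr₁₂ : r₁ < r₂) (x₀ : EuclideanSpace ℝ (Fin 3)) :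
    ∃ C : ℝ≥0, ∀ (v : ℝ → EuclideanSpace ℝ (Fin 3) → EuclideanSpace ℝ (Fin 3)) (t₁ : ℝ),
      ContDiff ℝ ∞ (uncurry v) →
      mixedNorm s n ((t₁, x₀) : ℝ × EuclideanSpace ℝ (Fin 3)) r₂ (uncurry v) +
          mixedNorm s n ((t₁, x₀) : ℝ × EuclideanSpace ℝ (Fin 3)) r₂
            (uncurry fun t x => fderiv ℝ (v t) x) +
          mixedNorm s n ((t₁, x₀) : ℝ × EuclideanSpace ℝ (Fin 3)) r₂
            (uncurry fun t x => timeDeriv v t x - (Δ (v t)) x) < ⊤ →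
      ∀ za ∈ parabolicCylinder r₁ ((t₁, x₀) : ℝ × EuclideanSpace ℝ (Fin 3)),
        ∀ zb ∈ parabolicCylinder r₁ ((t₁, x₀) : ℝ × EuclideanSpace ℝ (Fin 3)),
          edist (uncurry v za) (uncurry v zb) ≤
            C * (mixedNorm s n ((t₁, x₀) : ℝ × EuclideanSpace ℝ (Fin 3)) r₂ (uncurry v) +
                mixedNorm s n ((t₁, x₀) : ℝ × EuclideanSpace ℝ (Fin 3)) r₂
                  (uncurry fun t x => fderiv ℝ (v t) x) +
                mixedNorm s n ((t₁, x₀) : ℝ × EuclideanSpace ℝ (Fin 3)) r₂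
                  (uncurry fun t x => timeDeriv v t x - (Δ (v t)) x)) *
              ENNReal.ofReal ((dist za.2 zb.2 + |za.1 - zb.1| ^ (1 / 2 : ℝ)) ^
                (2 - 2 / n - 3 / s)) := by
  -- exponents and radii
  have hs1 : (1 : ℝ) ≤ s := hs.le
  have hn1 : (1 : ℝ) ≤ n := hn.le
  have hs0 : (0 : ℝ) < s := by linarith
  have hn0 : (0 : ℝ) < n := by linarith
  have hr₂ : 0 < r₂ := hr₁.trans hr₁₂
  obtain ⟨κ, hκ0, hκ⟩ := exists_parabolicHolderOnWith_heatPotential_of_mixedNorm hs hn hμ hμ1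
  set ρ₁ : ℝ := (2 * r₁ + r₂) / 3 with hρ₁
  set ρ₂ : ℝ := (r₁ + 2 * r₂) / 3 with hρ₂
  have hr₁ρ₁ : r₁ < ρ₁ := by rw [hρ₁]; linarith
  have hρ₁₂ : ρ₁ < ρ₂ := by rw [hρ₁, hρ₂]; linarith
  have hρ₂r₂ : ρ₂ < r₂ := by rw [hρ₂]; linarith
  have hρ₁0 : 0 < ρ₁ := hr₁.trans hr₁ρ₁
  have hρ₂0 : 0 < ρ₂ := hρ₁0.trans hρ₁₂
  have hρ₂r₂2 : ρ₂ ^ 2 < r₂ ^ 2 := by nlinarith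
  have hr₁ρ₁2 : r₁ ^ 2 < ρ₁ ^ 2 := by nlinarith
  -- the model cut-off, centred at time `0`, and its bounds
  obtain ⟨φ₀, hφ₀, hφ₀supp, hφ₀1⟩ :=
    exists_spaceTime_cutoff (((0 : ℝ), x₀) : ℝ × EuclideanSpace ℝ (Fin 3)) hρ₁0 hρ₁₂
  have hφ₀c : HasCompactSupport (uncurry φ₀) :=
    ((isCompact_closedBall _ _).prod (isCompact_closedBall _ _)).of_isClosed_subset
      (isClosed_tsupport _) hφ₀supp
  set b : OrthonormalBasis (Fin 3) ℝ (EuclideanSpace ℝ (Fin 3)) :=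
    EuclideanSpace.basisFun (Fin 3) ℝ with hb
  have hb1 : ∀ i, ‖b i‖ = 1 := fun i => b.orthonormal.1 i
  have hbe : ∀ l, b l = EuclideanSpace.single l (1 : ℝ) := fun l => by simp [hb]
  have h3 : (Finset.univ : Finset (Fin 3)).card = 3 := Finset.card_fin 3
  obtain ⟨M, hM0, hM⟩ := exists_cutoff_derivs_bound b hφ₀ hφ₀c
  set Mₑ : ℝ≥0∞ := ENNReal.ofReal M with hMₑ
  have hMₑ_top : Mₑ ≠ ⊤ := ENNReal.ofReal_ne_top
  -- the constant
  refine ⟨Real.toNNReal (18 * κ * M), fun v t₁ hv hS za hza zb hzb => ?_⟩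
  set z : ℝ × EuclideanSpace ℝ (Fin 3) := (t₁, x₀) with hz
  have hQm : MeasurableSet (parabolicCylinder r₂ z) := (isOpen_parabolicCylinder r₂ z).measurableSet
  set μQ : Measure (ℝ × EuclideanSpace ℝ (Fin 3)) := volume.restrict (parabolicCylinder r₂ z)
    with hμQ
  -- geometry of the points
  have hQ₁ : parabolicCylinder r₁ z ⊆ parabolicCylinder ρ₁ z :=
    prod_mono (Ioo_subset_Ioo_left (by linarith)) (ball_subset_ball hr₁ρ₁.le)
  have hza' := hQ₁ hza
  have hzb' := hQ₁ hzb
  have hta : za.1 < t₁ := ((mem_parabolicCylinder.1 hza).1).2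
  have htb : zb.1 < t₁ := ((mem_parabolicCylinder.1 hzb).1).2
  set T : ℝ := max za.1 zb.1 with hT
  have hTlt : T < t₁ := max_lt hta htb
  set T' : ℝ := (T + t₁) / 2 with hT'
  have hTT' : T < T' := by rw [hT']; linarith
  have hT't : T' < t₁ := by rw [hT']; linarith
  obtain ⟨ζ, hζ, hζ1, hζ0⟩ := exists_time_cutoff_le_eq_one hTT'
  -- the translated cut-off `φ(t, x) = φ₀(t - t₁, x)`
  set φ : ℝ → EuclideanSpace ℝ (Fin 3) → ℝ := fun t x => φ₀ (t - t₁) x with hφdef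
  have hφ : ContDiff ℝ ∞ (uncurry φ) := by
    have : uncurry φ = uncurry φ₀ ∘ fun p : ℝ × EuclideanSpace ℝ (Fin 3) => (p.1 - t₁, p.2) := by
      funext p; rfl
    rw [this]
    exact hφ₀.comp ((contDiff_fst.sub contDiff_const).prodMk contDiff_snd)
  have hφs : ∀ t, ContDiff ℝ ∞ (φ t) := fun t => hφ.comp (contDiff_prodMk_right t)
  have hφ2 : ∀ t, ContDiff ℝ 2 (φ t) := fun t => (hφs t).of_le (by norm_cast)
  have hφt : ∀ t x, timeDeriv φ t x = timeDeriv φ₀ (t - t₁) x := fun t x => by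
    simp only [timeDeriv, hφdef]
    exact deriv_comp_sub_const (f := fun r => φ₀ r x) (a := t₁) (x := t)
  have hMφ : ∀ w : ℝ × EuclideanSpace ℝ (Fin 3), |φ w.1 w.2| ≤ M ∧ |timeDeriv φ w.1 w.2| ≤ M ∧
      ∀ i, |fderiv ℝ (φ w.1) w.2 (b i)| ≤ M ∧
        |fderiv ℝ (fun y => fderiv ℝ (φ w.1) y (b i)) w.2 (b i)| ≤ M := by
    intro w
    have h := hM (w.1 - t₁, w.2)
    refine ⟨h.1, ?_, h.2.2⟩
    rw [hφt]
    exact h.2.1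
  have hφ0 : ∀ w : ℝ × EuclideanSpace ℝ (Fin 3), (w.1 - t₁, w.2) ∉ tsupport (uncurry φ₀) →
      φ w.1 w.2 = 0 ∧ timeDeriv φ w.1 w.2 = 0 ∧ fderiv ℝ (φ w.1) w.2 = 0 ∧ (Δ (φ w.1)) w.2 = 0 := by
    intro w hw
    refine ⟨(image_eq_zero_of_notMem_tsupport hw : uncurry φ₀ (w.1 - t₁, w.2) = 0), ?_,
      IsSpaceTimeTestOn.fderiv_slice_eq_zero_of_notMem (ψ := φ₀) (t := w.1 - t₁) (x := w.2) hw,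
      laplacian_slice_eq_zero_of_notMem_tsupport (ψ := φ₀) (t := w.1 - t₁) (x := w.2) hw⟩
    rw [hφt]
    exact IsSpaceTimeTestOn.timeDeriv_eq_zero_of_notMem hw
  have hφin : ∀ w : ℝ × EuclideanSpace ℝ (Fin 3), (w.1 - t₁, w.2) ∈ tsupport (uncurry φ₀) →
      t₁ - ρ₂ ^ 2 ≤ w.1 ∧ w.1 ≤ t₁ + ρ₂ ^ 2 ∧ dist w.2 x₀ ≤ ρ₂ := by
    intro w hw
    obtain ⟨h1, h2⟩ := hφ₀supp hw
    rw [mem_closedBall, Real.dist_eq, abs_le] at h1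
    rw [mem_closedBall] at h2
    dsimp only at h1 h2
    exact ⟨by linarith [h1.1], by linarith [h1.2], h2⟩
  have hφ1 : ∀ w ∈ parabolicCylinder ρ₁ z, φ w.1 w.2 = 1 := by
    intro w hw
    rw [mem_parabolicCylinder] at hw
    have hw' : ((w.1 - t₁, w.2) : ℝ × EuclideanSpace ℝ (Fin 3)) ∈
        parabolicCylinder ρ₁ (((0 : ℝ), x₀) : ℝ × EuclideanSpace ℝ (Fin 3)) := by
      rw [mem_parabolicCylinder]
      dsimp only
      exact ⟨⟨by linarith [hw.1.1], by linarith [hw.1.2]⟩, hw.2⟩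
    exact hφ₀1 _ hw'
  -- smoothness and continuity of the data of `v`
  have hvs : ∀ t, ContDiff ℝ ∞ (v t) := fun t => hv.comp (contDiff_prodMk_right t)
  have hv2 : ∀ t, ContDiff ℝ 2 (v t) := fun t => (hvs t).of_le (by norm_cast)
  have hvd : ∀ t, Differentiable ℝ (v t) := fun t => (hvs t).differentiable (by simp)
  set Dv : ℝ × EuclideanSpace ℝ (Fin 3) → EuclideanSpace ℝ (Fin 3) →L[ℝ] EuclideanSpace ℝ (Fin 3) :=
    fun w => fderiv ℝ (v w.1) w.2 with hDv
  set Hv : ℝ × EuclideanSpace ℝ (Fin 3) → EuclideanSpace ℝ (Fin 3) := fun w =>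
    timeDeriv v w.1 w.2 - (Δ (v w.1)) w.2 with hHv
  have hvc : Continuous (uncurry v) := hv.continuous
  have hDvc : Continuous Dv := continuous_fderiv_slice_of_uncurry hv
  have hHvc : Continuous Hv :=
    (contDiff_uncurry_timeDeriv_of_uncurry hv).continuous.sub
      (continuous_laplacian_slice_of_uncurry hv)
  -- the total size
  set S : ℝ≥0∞ := mixedNorm s n z r₂ (uncurry v) + mixedNorm s n z r₂ Dv +
    mixedNorm s n z r₂ Hv with hSdef
  have hSlt : S < ⊤ := hS
  have h6MS : 6 * Mₑ * S < ⊤ :=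
    ENNReal.mul_lt_top (ENNReal.mul_lt_top (by norm_num)
      (by rw [hMₑ]; exact ENNReal.ofReal_lt_top)) hSlt
  -- the majorant of the scalar sources and its mixed norm
  set Φm : ℝ × EuclideanSpace ℝ (Fin 3) → ℝ≥0∞ := fun w =>
    Mₑ * ‖Hv w‖ₑ + 4 * Mₑ * ‖uncurry v w‖ₑ + 6 * Mₑ * ‖Dv w‖ₑ with hΦm
  have hΦmN : mixedNorm s n z r₂ Φm ≤ 6 * Mₑ * S := by
    have hA₁ : AEMeasurable (fun w => Mₑ * ‖Hv w‖ₑ) μQ :=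
      hHvc.aestronglyMeasurable.enorm.const_mul _
    have hA₂ : AEMeasurable (fun w => 4 * Mₑ * ‖uncurry v w‖ₑ) μQ :=
      hvc.aestronglyMeasurable.enorm.const_mul _
    have hA₃ : AEMeasurable (fun w => 6 * Mₑ * ‖Dv w‖ₑ) μQ :=
      hDvc.aestronglyMeasurable.enorm.const_mul _
    have hN1 : mixedNorm s n z r₂ (fun w => Mₑ * ‖Hv w‖ₑ) = Mₑ * mixedNorm s n z r₂ Hv := by
      rw [mixedNorm_const_mul hs0 hn0 z r₂ hMₑ_top, mixedNorm_enorm]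
    have hN2 : mixedNorm s n z r₂ (fun w => 4 * Mₑ * ‖uncurry v w‖ₑ) =
        4 * Mₑ * mixedNorm s n z r₂ (uncurry v) := by
      rw [mixedNorm_const_mul hs0 hn0 z r₂ (ENNReal.mul_ne_top (by norm_num) hMₑ_top),
        mixedNorm_enorm]
    have hN3 : mixedNorm s n z r₂ (fun w => 6 * Mₑ * ‖Dv w‖ₑ) = 6 * Mₑ * mixedNorm s n z r₂ Dv := by
      rw [mixedNorm_const_mul hs0 hn0 z r₂ (ENNReal.mul_ne_top (by norm_num) hMₑ_top),
        mixedNorm_enorm]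
    calc mixedNorm s n z r₂ Φm
        ≤ mixedNorm s n z r₂ (fun w => Mₑ * ‖Hv w‖ₑ + 4 * Mₑ * ‖uncurry v w‖ₑ) +
            mixedNorm s n z r₂ (fun w => 6 * Mₑ * ‖Dv w‖ₑ) :=
          mixedNorm_add_le_of_aemeasurable hs1 hn1 z r₂ (hA₁.add hA₂) hA₃
      _ ≤ mixedNorm s n z r₂ (fun w => Mₑ * ‖Hv w‖ₑ) +
            mixedNorm s n z r₂ (fun w => 4 * Mₑ * ‖uncurry v w‖ₑ) +
            mixedNorm s n z r₂ (fun w => 6 * Mₑ * ‖Dv w‖ₑ) := by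
          gcongr
          exact mixedNorm_add_le_of_aemeasurable hs1 hn1 z r₂ hA₁ hA₂
      _ = Mₑ * mixedNorm s n z r₂ Hv + 4 * Mₑ * mixedNorm s n z r₂ (uncurry v) +
            6 * Mₑ * mixedNorm s n z r₂ Dv := by rw [hN1, hN2, hN3]
      _ ≤ Mₑ * mixedNorm s n z r₂ Hv + 4 * Mₑ * mixedNorm s n z r₂ (uncurry v) +
            6 * Mₑ * mixedNorm s n z r₂ Dv +
            (5 * Mₑ * mixedNorm s n z r₂ Hv + 2 * Mₑ * mixedNorm s n z r₂ (uncurry v)) :=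
          le_self_add
      _ = 6 * Mₑ * S := by rw [hSdef]; ring
  ------------------------------------------------------------------
  -- the coordinate-wise estimate
  ------------------------------------------------------------------
  have hcoord : ∀ i : Fin 3, |v za.1 za.2 i - v zb.1 zb.2 i| ≤
      κ * (6 * M * S.toReal) * parabolicDist za zb ^ (2 - 2 / n - 3 / s) := by
    intro i
    -- the coordinate field and its derived fields
    set vi : ℝ → EuclideanSpace ℝ (Fin 3) → ℝ := fun t x => v t x i with hvi_def
    have hvi : ContDiff ℝ ∞ (uncurry vi) := by
      have : uncurry vi =
          (EuclideanSpace.proj i : EuclideanSpace ℝ (Fin 3) →L[ℝ] ℝ) ∘ uncurry v := rfl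
      rw [this]
      exact (EuclideanSpace.proj i : EuclideanSpace ℝ (Fin 3) →L[ℝ] ℝ).contDiff.comp hv
    have hvis : ∀ t, ContDiff ℝ ∞ (vi t) := fun t => hvi.comp (contDiff_prodMk_right t)
    have hvi2 : ∀ t, ContDiff ℝ 2 (vi t) := fun t => (hvis t).of_le (by norm_cast)
    -- coordinate identities
    have hc1 : ∀ t x, timeDeriv vi t x = timeDeriv v t x i := fun t x =>
      (timeDeriv_apply_coord hv t x i).symm
    have hc2 : ∀ t x, (Δ (vi t)) x = (Δ (v t)) x i := fun t x =>
      (laplacian_apply_coord (hv2 t) x i).symm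
    have hc3 : ∀ t x a, fderiv ℝ (vi t) x a = fderiv ℝ (v t) x a i := fun t x a =>
      (Tsai2021.fderiv_apply_coord (hvd t) x a i).symm
    -- the scalar source `(∂ₜ - Δ)(φ vᵢ)`
    set src : ℝ × EuclideanSpace ℝ (Fin 3) → ℝ := fun w =>
      φ w.1 w.2 * (timeDeriv vi w.1 w.2 - (Δ (vi w.1)) w.2) +
        (timeDeriv φ w.1 w.2 - (Δ (φ w.1)) w.2) * vi w.1 w.2 -
        2 * ∑ l : Fin 3, fderiv ℝ (φ w.1) w.2 (EuclideanSpace.single l (1 : ℝ)) *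
          fderiv ℝ (vi w.1) w.2 (EuclideanSpace.single l (1 : ℝ)) with hsrc
    have hsrc_cont : Continuous src := by
      have c1 : Continuous fun w : ℝ × EuclideanSpace ℝ (Fin 3) => φ w.1 w.2 := hφ.continuous
      have c2 : Continuous fun w : ℝ × EuclideanSpace ℝ (Fin 3) => timeDeriv vi w.1 w.2 :=
        (contDiff_uncurry_timeDeriv_of_uncurry hvi).continuous
      have c3 : Continuous fun w : ℝ × EuclideanSpace ℝ (Fin 3) => (Δ (vi w.1)) w.2 :=
        continuous_laplacian_slice_of_uncurry hvi
      have c4 : Continuous fun w : ℝ × EuclideanSpace ℝ (Fin 3) => timeDeriv φ w.1 w.2 :=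
        (contDiff_uncurry_timeDeriv_of_uncurry hφ).continuous
      have c5 : Continuous fun w : ℝ × EuclideanSpace ℝ (Fin 3) => (Δ (φ w.1)) w.2 :=
        continuous_laplacian_slice_of_uncurry hφ
      have c6 : Continuous fun w : ℝ × EuclideanSpace ℝ (Fin 3) => vi w.1 w.2 := hvi.continuous
      have c7 : ∀ l : Fin 3, Continuous fun w : ℝ × EuclideanSpace ℝ (Fin 3) =>
          fderiv ℝ (φ w.1) w.2 (EuclideanSpace.single l (1 : ℝ)) := fun l =>
        (contDiff_uncurry_fderiv_apply_of_uncurry hφ _).continuous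
      have c8 : ∀ l : Fin 3, Continuous fun w : ℝ × EuclideanSpace ℝ (Fin 3) =>
          fderiv ℝ (vi w.1) w.2 (EuclideanSpace.single l (1 : ℝ)) := fun l =>
        (contDiff_uncurry_fderiv_apply_of_uncurry hvi _).continuous
      simp only [hsrc]
      exact ((c1.mul (c2.sub c3)).add ((c4.sub c5).mul c6)).sub
        (continuous_const.mul (continuous_finsetSum _ fun l _ => (c7 l).mul (c8 l)))
    -- the cut-off coordinate `Φ = ζ φ vᵢ` is a space–time test field
    set ψ : ℝ → EuclideanSpace ℝ (Fin 3) → ℝ := fun t x => φ t x * vi t x with hψ_def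
    set Φ : ℝ → EuclideanSpace ℝ (Fin 3) → ℝ := fun t x => ζ t * ψ t x with hΦ_def
    have hψ : ContDiff ℝ ∞ (uncurry ψ) := hφ.mul hvi
    have hΦsm : ContDiff ℝ ∞ (uncurry Φ) := (hζ.comp contDiff_fst).mul hψ
    have hΦtest : IsSpaceTimeTestOn (⊤ : Opens (ℝ × EuclideanSpace ℝ (Fin 3))) Φ := by
      refine ⟨hΦsm, ?_, fun _ _ => trivial⟩
      refine HasCompactSupport.intro (K := Icc (t₁ - ρ₂ ^ 2) T' ×ˢ closedBall x₀ ρ₂)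
        (isCompact_Icc.prod (isCompact_closedBall _ _)) fun w hw => ?_
      change ζ w.1 * (φ w.1 w.2 * vi w.1 w.2) = 0
      by_cases h1 : T' ≤ w.1
      · rw [hζ0 _ h1, zero_mul]
      · have hns : (w.1 - t₁, w.2) ∉ tsupport (uncurry φ₀) := fun hmem => hw (by
          obtain ⟨a1, -, a3⟩ := hφin w hmem
          exact ⟨⟨a1, (not_le.1 h1).le⟩, mem_closedBall.2 a3⟩)
        rw [(hφ0 w hns).1, zero_mul, mul_zero]
    -- below the time `T` the heat operator of `Φ` is the source
    have hsrc_eq : ∀ w : ℝ × EuclideanSpace ℝ (Fin 3), w.1 < T →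
        timeDeriv Φ w.1 w.2 - (1 : ℝ) • (Δ (Φ w.1)) w.2 = src w := by
      rintro ⟨t, x⟩ ht
      dsimp only at ht ⊢
      have hζnear : ∀ᶠ r in 𝓝 t, ζ r = 1 :=
        Filter.eventually_of_mem (Iio_mem_nhds ht) fun r hr => hζ1 r (le_of_lt hr)
      have e1 : timeDeriv Φ t x = timeDeriv ψ t x := by
        simp only [timeDeriv]
        refine Filter.EventuallyEq.deriv_eq ?_
        filter_upwards [hζnear] with r hr
        change ζ r * ψ r x = ψ r x
        rw [hr, one_mul]
      have e2 : Φ t = ψ t := by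
        funext y
        change ζ t * ψ t y = ψ t y
        rw [hζ1 t ht.le, one_mul]
      have hdφ : DifferentiableAt ℝ (fun r => φ r x) t :=
        ((hφ.differentiable (by simp)).comp (differentiable_id.prodMk (differentiable_const x))) t
      have hdv : DifferentiableAt ℝ (fun r => vi r x) t :=
        ((hvi.differentiable (by simp)).comp (differentiable_id.prodMk (differentiable_const x))) t
      have e3 : timeDeriv ψ t x = timeDeriv φ t x * vi t x + φ t x * timeDeriv vi t x := by
        simp only [timeDeriv, hψ_def]
        exact deriv_mul hdφ hdv
      have e4 : (Δ (ψ t)) x = φ t x * (Δ (vi t)) x +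
          2 * ∑ l : Fin 3, fderiv ℝ (φ t) x (EuclideanSpace.single l (1 : ℝ)) *
            fderiv ℝ (vi t) x (EuclideanSpace.single l (1 : ℝ)) + vi t x * (Δ (φ t)) x :=
        Tsai2021.laplacian_mul_eq (hφ2 t) (hvi2 t) x
      rw [e1, e2, e3, e4, one_smul]
      simp only [hsrc]
      ring
    -- the truncated source `F`, measurable, supported in `Q(z, r₂)`, dominated by `Φm`
    set F : ℝ × EuclideanSpace ℝ (Fin 3) → ℝ := fun w => if w.1 < T then src w else 0 with hF
    have hFm : Measurable F :=
      Measurable.ite (measurableSet_lt measurable_fst measurable_const) hsrc_cont.measurable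
        measurable_const
    have hF0 : ∀ w ∉ parabolicCylinder r₂ z, F w = 0 := by
      intro w hw
      simp only [hF]
      split_ifs with hwT
      · have hns : (w.1 - t₁, w.2) ∉ tsupport (uncurry φ₀) := fun hmem => hw (by
          obtain ⟨a1, -, a3⟩ := hφin w hmem
          rw [mem_parabolicCylinder]
          exact ⟨⟨by linarith, by linarith⟩, lt_of_le_of_lt a3 hρ₂r₂⟩)
        obtain ⟨h0, h1, h2, h3⟩ := hφ0 w hns
        simp only [hsrc, h0, h1, h2, h3, _root_.zero_apply, zero_mul, mul_zero,
          sub_zero, zero_add, Finset.sum_const_zero]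
      · rfl
    have hsrc_le : ∀ w, ‖src w‖ₑ ≤ Φm w := by
      intro w
      obtain ⟨hw0, hwt, hwi⟩ := hMφ w
      -- the pieces, in real form
      have p1 : |timeDeriv vi w.1 w.2 - (Δ (vi w.1)) w.2| ≤ ‖Hv w‖ := by
        rw [hc1, hc2]
        have : timeDeriv v w.1 w.2 i - (Δ (v w.1)) w.2 i = (Hv w) i := by
          simp only [hHv, PiLp.sub_apply]
        rw [this, ← Real.norm_eq_abs]
        exact PiLp.norm_apply_le (Hv w) i
      have p2 : |vi w.1 w.2| ≤ ‖uncurry v w‖ := by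
        rw [← Real.norm_eq_abs]
        exact PiLp.norm_apply_le (v w.1 w.2) i
      have p3 : ∀ l : Fin 3, |fderiv ℝ (vi w.1) w.2 (EuclideanSpace.single l (1 : ℝ))| ≤
          ‖Dv w‖ := fun l => by
        rw [hc3, ← Real.norm_eq_abs]
        calc ‖fderiv ℝ (v w.1) w.2 (EuclideanSpace.single l (1 : ℝ)) i‖
            ≤ ‖fderiv ℝ (v w.1) w.2 (EuclideanSpace.single l (1 : ℝ))‖ := PiLp.norm_apply_le _ i
          _ ≤ ‖fderiv ℝ (v w.1) w.2‖ * ‖(EuclideanSpace.single l (1 : ℝ) :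
              EuclideanSpace ℝ (Fin 3))‖ := ContinuousLinearMap.le_opNorm _ _
          _ = ‖Dv w‖ := by rw [norm_single_one, mul_one]
      have p4 : ∀ l : Fin 3, |fderiv ℝ (φ w.1) w.2 (EuclideanSpace.single l (1 : ℝ))| ≤ M :=
        fun l => by rw [← hbe]; exact (hwi l).1
      have p5 : |(Δ (φ w.1)) w.2| ≤ 3 * M := by
        rw [Tsai2021.laplacian_eq_sum_three (hφ2 w.1) w.2]
        calc |∑ l : Fin 3, fderiv ℝ (fun y => fderiv ℝ (φ w.1) y
              (EuclideanSpace.single l (1 : ℝ))) w.2 (EuclideanSpace.single l (1 : ℝ))|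
            ≤ ∑ l : Fin 3, |fderiv ℝ (fun y => fderiv ℝ (φ w.1) y
              (EuclideanSpace.single l (1 : ℝ))) w.2 (EuclideanSpace.single l (1 : ℝ))| :=
              Finset.abs_sum_le_sum_abs _ _
          _ ≤ ∑ _l : Fin 3, M := Finset.sum_le_sum fun l _ => by
              have := (hwi l).2
              rw [hbe] at this
              exact this
          _ = 3 * M := by rw [Finset.sum_const, h3, nsmul_eq_mul]; push_cast; ring
      have p6 : |∑ l : Fin 3, fderiv ℝ (φ w.1) w.2 (EuclideanSpace.single l (1 : ℝ)) *
          fderiv ℝ (vi w.1) w.2 (EuclideanSpace.single l (1 : ℝ))| ≤ 3 * (M * ‖Dv w‖) := by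
        calc |∑ l : Fin 3, fderiv ℝ (φ w.1) w.2 (EuclideanSpace.single l (1 : ℝ)) *
              fderiv ℝ (vi w.1) w.2 (EuclideanSpace.single l (1 : ℝ))|
            ≤ ∑ l : Fin 3, |fderiv ℝ (φ w.1) w.2 (EuclideanSpace.single l (1 : ℝ)) *
              fderiv ℝ (vi w.1) w.2 (EuclideanSpace.single l (1 : ℝ))| :=
              Finset.abs_sum_le_sum_abs _ _
          _ ≤ ∑ _l : Fin 3, M * ‖Dv w‖ := Finset.sum_le_sum fun l _ => by
              rw [abs_mul]
              exact mul_le_mul (p4 l) (p3 l) (abs_nonneg _) hM0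
          _ = 3 * (M * ‖Dv w‖) := by rw [Finset.sum_const, h3, nsmul_eq_mul]; push_cast; ring
      have hreal : |src w| ≤ M * ‖Hv w‖ + 4 * M * ‖uncurry v w‖ + 6 * M * ‖Dv w‖ := by
        have q1 : |φ w.1 w.2 * (timeDeriv vi w.1 w.2 - (Δ (vi w.1)) w.2)| ≤ M * ‖Hv w‖ := by
          rw [abs_mul]; exact mul_le_mul hw0 p1 (abs_nonneg _) hM0
        have q2 : |(timeDeriv φ w.1 w.2 - (Δ (φ w.1)) w.2) * vi w.1 w.2| ≤
            4 * M * ‖uncurry v w‖ := by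
          rw [abs_mul]
          refine mul_le_mul ((abs_sub _ _).trans ?_) p2 (abs_nonneg _) (by positivity)
          linarith
        have q3 : |2 * ∑ l : Fin 3, fderiv ℝ (φ w.1) w.2 (EuclideanSpace.single l (1 : ℝ)) *
            fderiv ℝ (vi w.1) w.2 (EuclideanSpace.single l (1 : ℝ))| ≤ 6 * M * ‖Dv w‖ := by
          rw [abs_mul, abs_of_pos (two_pos : (0 : ℝ) < 2)]
          linarith [p6]
        simp only [hsrc]
        calc |φ w.1 w.2 * (timeDeriv vi w.1 w.2 - (Δ (vi w.1)) w.2) +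
              (timeDeriv φ w.1 w.2 - (Δ (φ w.1)) w.2) * vi w.1 w.2 -
              2 * ∑ l : Fin 3, fderiv ℝ (φ w.1) w.2 (EuclideanSpace.single l (1 : ℝ)) *
                fderiv ℝ (vi w.1) w.2 (EuclideanSpace.single l (1 : ℝ))|
            ≤ |φ w.1 w.2 * (timeDeriv vi w.1 w.2 - (Δ (vi w.1)) w.2) +
                (timeDeriv φ w.1 w.2 - (Δ (φ w.1)) w.2) * vi w.1 w.2| +
              |2 * ∑ l : Fin 3, fderiv ℝ (φ w.1) w.2 (EuclideanSpace.single l (1 : ℝ)) *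
                fderiv ℝ (vi w.1) w.2 (EuclideanSpace.single l (1 : ℝ))| := abs_sub _ _
          _ ≤ |φ w.1 w.2 * (timeDeriv vi w.1 w.2 - (Δ (vi w.1)) w.2)| +
                |(timeDeriv φ w.1 w.2 - (Δ (φ w.1)) w.2) * vi w.1 w.2| +
              |2 * ∑ l : Fin 3, fderiv ℝ (φ w.1) w.2 (EuclideanSpace.single l (1 : ℝ)) *
                fderiv ℝ (vi w.1) w.2 (EuclideanSpace.single l (1 : ℝ))| := by
              gcongr
              exact abs_add_le _ _
          _ ≤ M * ‖Hv w‖ + 4 * M * ‖uncurry v w‖ + 6 * M * ‖Dv w‖ := by linarith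
      -- pass to `ℝ≥0∞`
      have hrhs : ENNReal.ofReal (M * ‖Hv w‖ + 4 * M * ‖uncurry v w‖ + 6 * M * ‖Dv w‖) = Φm w := by
        simp only [hΦm, hMₑ]
        rw [ENNReal.ofReal_add (by positivity) (by positivity),
          ENNReal.ofReal_add (by positivity) (by positivity),
          ENNReal.ofReal_mul hM0, ENNReal.ofReal_mul (by positivity),
          ENNReal.ofReal_mul (by positivity), ENNReal.ofReal_mul (by positivity),
          ENNReal.ofReal_mul (by positivity), ofReal_norm, ofReal_norm, ofReal_norm,
          ENNReal.ofReal_ofNat, ENNReal.ofReal_ofNat]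
      rw [← hrhs, Real.enorm_eq_ofReal_abs]
      exact ENNReal.ofReal_le_ofReal hreal
    have hFle : ∀ w, ‖F w‖ₑ ≤ Φm w := fun w => by
      simp only [hF]
      split_ifs
      · exact hsrc_le w
      · simp
    have hFN : mixedNorm s n z r₂ F ≤ 6 * Mₑ * S :=
      (mixedNorm_mono hs0.le hn0 (F' := Φm) fun w _ => by
        simpa only [enorm_eq_self] using hFle w).trans hΦmN
    have hFfin : mixedNorm s n z r₂ F < ⊤ := lt_of_le_of_lt hFN h6MS
    -- the heat potential of `F` and its Hölder continuity
    have hHol := hκ z r₂ F hFm hF0 hFfin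
    -- its values at the two points: causality and the representation of `Φ`
    have hval : ∀ zc : ℝ × EuclideanSpace ℝ (Fin 3), zc ∈ parabolicCylinder ρ₁ z → zc.1 ≤ T →
        (∫ w, heatKernelFwd 1 (zc - w) * F w) = vi zc.1 zc.2 := by
      intro zc hzc hzcT
      have h1 : (∫ w, heatKernelFwd 1 (zc - w) * F w) =
          heatPotential 1 (fun w : ℝ × EuclideanSpace ℝ (Fin 3) =>
            timeDeriv Φ w.1 w.2 - (1 : ℝ) • (Δ (Φ w.1)) w.2) zc := by
        rw [heatPotential]
        refine integral_congr_ae (Eventually.of_forall fun w => ?_)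
        beta_reduce
        by_cases hw : w.1 < zc.1
        · rw [hsrc_eq w (lt_of_lt_of_le hw hzcT), smul_eq_mul]
          simp only [hF, if_pos (lt_of_lt_of_le hw hzcT)]
        · have h0 : heatKernelFwd 1 (zc - w) = 0 :=
            heatKernelFwd_of_nonpos 1 (by rw [Prod.fst_sub]; linarith)
          rw [h0, zero_mul, zero_smul]
      rw [h1, hΦtest.heatPotential_heatOperator one_pos zc]
      change ζ zc.1 * (φ zc.1 zc.2 * vi zc.1 zc.2) = vi zc.1 zc.2
      rw [hζ1 _ hzcT, hφ1 zc hzc, one_mul, one_mul]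
    have hVa := hval za hza' (le_max_left _ _)
    have hVb := hval zb hzb' (le_max_right _ _)
    -- conclude
    have hH := hHol za (mem_univ _) zb (mem_univ _)
    beta_reduce at hH
    rw [hVa, hVb, Real.norm_eq_abs] at hH
    refine hH.trans (mul_le_mul_of_nonneg_right (mul_le_mul_of_nonneg_left ?_ hκ0)
      (Real.rpow_nonneg (parabolicDist_nonneg _ _) _))
    have h6 : (6 * Mₑ * S).toReal = 6 * M * S.toReal := by
      rw [ENNReal.toReal_mul, ENNReal.toReal_mul, hMₑ, ENNReal.toReal_ofReal hM0]
      norm_num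
    rw [← h6]
    exact ENNReal.toReal_mono h6MS.ne hFN
  ------------------------------------------------------------------
  -- assembling the coordinates
  ------------------------------------------------------------------
  have hpd : parabolicDist za zb = dist za.2 zb.2 + |za.1 - zb.1| ^ (1 / 2 : ℝ) := by
    rw [parabolicDist, Real.sqrt_eq_rpow, dist_eq_norm, add_comm]
  have hSr : S = ENNReal.ofReal S.toReal := (ENNReal.ofReal_toReal hSlt.ne).symm
  have hS0 : 0 ≤ S.toReal := ENNReal.toReal_nonneg
  have hsum : ‖v za.1 za.2 - v zb.1 zb.2‖ ≤
      3 * (κ * (6 * M * S.toReal) * parabolicDist za zb ^ (2 - 2 / n - 3 / s)) := by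
    calc ‖v za.1 za.2 - v zb.1 zb.2‖ ≤ ∑ i, |(v za.1 za.2 - v zb.1 zb.2) i| :=
          norm_le_sum_abs_coord _
      _ = ∑ i, |v za.1 za.2 i - v zb.1 zb.2 i| := by simp only [PiLp.sub_apply]
      _ ≤ ∑ _i : Fin 3, κ * (6 * M * S.toReal) * parabolicDist za zb ^ (2 - 2 / n - 3 / s) :=
          Finset.sum_le_sum fun i _ => hcoord i
      _ = 3 * (κ * (6 * M * S.toReal) * parabolicDist za zb ^ (2 - 2 / n - 3 / s)) := by
          rw [Finset.sum_const, h3, nsmul_eq_mul]; push_cast; ring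
  change edist (v za.1 za.2) (v zb.1 zb.2) ≤ _
  rw [edist_dist, dist_eq_norm]
  calc ENNReal.ofReal ‖v za.1 za.2 - v zb.1 zb.2‖
      ≤ ENNReal.ofReal
          (3 * (κ * (6 * M * S.toReal) * parabolicDist za zb ^ (2 - 2 / n - 3 / s))) :=
        ENNReal.ofReal_le_ofReal hsum
    _ = ENNReal.ofReal (18 * κ * M) * ENNReal.ofReal S.toReal *
          ENNReal.ofReal (parabolicDist za zb ^ (2 - 2 / n - 3 / s)) := by
        rw [← ENNReal.ofReal_mul (show (0 : ℝ) ≤ 18 * κ * M by positivity),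
          ← ENNReal.ofReal_mul (show (0 : ℝ) ≤ 18 * κ * M * S.toReal by positivity)]
        congr 1
        ring
    _ = (Real.toNNReal (18 * κ * M) : ℝ≥0∞) * S *
          ENNReal.ofReal ((dist za.2 zb.2 + |za.1 - zb.1| ^ (1 / 2 : ℝ)) ^
            (2 - 2 / n - 3 / s)) := by
        rw [← hpd, ← hSr]
        rfl

end Main

end Literature.Analysis.FluidPDE

end
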